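import Summits.Ventures.YMGap.Conjectures.StrongCouplingSUNChiralLROBeta
import Summits.Ventures.YMGap.Conjectures.StrongCouplingChiralLROSchwingerDysonSmallBeta
import Literature.MathematicalPhysics.QuantumLattice.StaggeredSchwingerDysonFixedGaugeSU
import HarnessLib
import HarnessLib.Audit.Tags

/-!
# The Schwinger–Dyson side for `SU(N)` at `β ≥ 0` (1/3): objects, the Schwinger–Dyson identity at `β`,
# one-link resampling over `SU(N)` and the plaquette oscillation

Cell `pub-ymgap`, seat qcd-lit g27 (literature-prover), `bears_on: Q1` — what the `SU(N)` extension of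
Salmhofer–Seiler §5 p. 424 needs at `β > 0`.  Everything is a theorem (0 facts, 0 sorry).  This is the `SU(N)`
twin of `…ChiralLROSchwingerDysonSetup/OneLink` (qcd-lit g19, `G = U(N)`), written for the `β`-dressed `SU(N)`
functional `suJB`/`suSB` of `…SUNChiralLROMesonWeightBeta` (all-antiperiodic massless staggered fermion,
Wilson action in the defining representation):

* `fWSU V = e^{A(V)}` — the massless fermionic Boltzmann element read on `SU(N) ⊂ U(N)`;
  `suKinJ β x e F = ∫ e^{-βS_W(V)} ∫dψ̄dψ F·kin_{x,e}(V)·e^{A(V)} ∏dV` — one bond term of the Schwinger–Dyson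
  equation;
* **`suSB_schwingerDyson`** — `(N - n) S_β(F) = ∑_{e ∋ x} Re(s I_e(F))` for `N_x F = nF` (Grassmann
  integration by parts at fixed gauge field, `schwingerDyson_fixedGauge`, integrated against `e^{-βS_W}∏dV`);
* `suJB_eq_integral_prod`, `suSB_eq_integral_prod`, `suKinJ_eq_integral_prod` — resampling the variable of one
  link (`GaugeLinkResampling`);
* `plaqSU_update_le`, `abs_plaqSU_update_sub_le` — the one-link oscillation of the `SU(N)` Wilson weight,
  `e^{-βS_W(V[e←g])} ≤ e^{βc} e^{-βS_W(V[e←h])}`, `c = linkOsc ν N` volume-independent;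
* `norm_berezin_kinAt_le_SU` — the pointwise Cauchy–Schwarz bound of the kinetic insertion at every `SU(N)`
  gauge field: `|∫dψ̄dψ F kin_{x,e}(V) e^{A(V)}| ≤ (N√N/2)(s∫F(σσ)_e e^{A(V)} + s∫F e^{A(V)})`.

Honest framing: finite even torus, one staggered flavour; identities and pointwise bounds only; nothing about
the thermodynamic/continuum limit or the summit's QCD conjunct.  The baryon loops enter in the sequel.

## References
* [SalmhoferSeiler1991] M. Salmhofer, E. Seiler, Commun. Math. Phys. 139 (1991) 395–432, §2 (2.2)–(2.12),
  (3.44)–(3.46), (3.61)–(3.62), (4.31), §5 p. 424.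
* [SeilerLNP1982] E. Seiler, LNP 159 (1982), Ch. 2 (one-link oscillation of the plaquette weight).
* [MontvayMunster1994] I. Montvay, G. Münster, *Quantum Fields on a Lattice* (1994) §5.1.4 (5.42), §5.1.6
  (5.120)–(5.121).
-/

noncomputable section

open MeasureTheory Finset
open scoped ComplexConjugate Matrix BigOperators
open Literature.MathematicalPhysics.QuantumFieldTheory (Site Edge GaugeConfig wilsonAction haarProbability)
open Literature.MathematicalPhysics.QuantumLattice
open Literature.MathematicalPhysics.QuantumLattice.GrassmannAlgebra
open Literature.MathematicalPhysics.QuantumLattice.StrongCoupling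
open Literature.MathematicalPhysics.QuantumLattice.StaggeredDeterminant (eoParity)
open Literature.MathematicalPhysics.StatisticalMechanics (ComplexSpin.uNBondCoeff)
open Literature.Probability.LatticeModels (TorusSite)

namespace Summit.Ventures.YMGap.Conjectures

namespace SchwingerDysonSU

open SchwingerDyson MesonWeightSU

variable {N ν L : ℕ} [NeZero ν] [NeZero L] [LinearOrder (TorusSite ν L)]

/-! ### The objects -/

/-- **The massless fermionic Boltzmann element `e^{A(V)}` for the `SU(N)` gauge field** (all-antiperiodic
signs), the `U(N)` expression read on `SU(N) ⊂ U(N)`. [cite: SalmhoferSeiler1991, §2 (2.3)] -/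
abbrev fWSU (V : GaugeConfig ν L (OneLink.SUN N)) : FermiAlg (TorusSite ν L) N :=
  grassmannExp (actionOn Finset.univ (torusLinks ν L) (apSigns ν L) fun b => OneLink.inclSU N (V b))

/-- `e^{-S_F(V)}|_{m=0} = e^{A(V)}`. [cite: SalmhoferSeiler1991, §2 (2.3), (2.9)] -/
theorem fermiBoltzmannSU_eq_fWSU (V : GaugeConfig ν L (OneLink.SUN N)) :
    fermiBoltzmannSU (torusLinks ν L) (apSigns ν L) 0 V = fWSU (N := N) V := by
  rw [fermiBoltzmannSU, fermiBoltzmann_zero_eq_grassmannExp_actionOn]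

variable (N ν L) in
/-- **One bond term of the Schwinger–Dyson equation at coupling `β`**:
`I_e(F) = ∫ e^{-βS_W(V)} ∫dψ̄dψ F · kin_{x,e}(V) · e^{A(V)} ∏dV`. [cite: SalmhoferSeiler1991, (3.46) and (4.31)] -/
def suKinJ (β : ℝ) (x : TorusSite ν L) (e : Edge ν L) (F : FermiAlg (TorusSite ν L) N) : ℂ :=
  ∫ V, (plaqSU N ν L β V : ℂ) * berezin ℂ _ (F *
    kinAt x (torusLinks ν L) (apSigns ν L) (fun b => OneLink.inclSU N (V b)) e * fWSU V)
      ∂(gaugeMeasureSU N (Edge ν L))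

/-! ### Regularity -/

omit [NeZero ν] [NeZero L] [LinearOrder (TorusSite ν L)] in
/-- The inclusion `SU(N) → U(N)` is continuous. [cite: SalmhoferSeiler1991, §2 (2.12)] -/
theorem continuous_inclSU' : Continuous (OneLink.inclSU N : OneLink.SUN N → OneLink.UN N) :=
  continuous_induced_rng.2 continuous_subtype_val

omit [NeZero ν] [NeZero L] [LinearOrder (TorusSite ν L)] in
/-- The inclusion of the `SU(N)` gauge field into `U(N)` matrices is continuous. [cite: SalmhoferSeiler1991, §2 (2.12)] -/
theorem continuous_inclSU_comp : Continuous fun V : GaugeConfig ν L (OneLink.SUN N) =>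
    (fun b => OneLink.inclSU N (V b) : GaugeConfig ν L (OneLink.UN N)) :=
  continuous_pi fun b => (continuous_inclSU' (N := N)).comp (continuous_apply b)

/-- `e^{A(V)}` depends continuously on the `SU(N)` gauge field. [cite: SalmhoferSeiler1991, §2 (2.12)] -/
theorem coeffContinuous_fWSU (hL : Even L) : CoeffContinuous fun V : GaugeConfig ν L (OneLink.SUN N) => fWSU (N := N) V := by
  have hfun : (fun V : GaugeConfig ν L (OneLink.SUN N) => fWSU (N := N) V) =
      fermiBoltzmannSU (torusLinks ν L) (apSigns ν L) 0 := funext fun V => (fermiBoltzmannSU_eq_fWSU V).symm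
  rw [hfun]
  exact coeffContinuous_fermiBoltzmannSU _ (torusLinks_ne (StaggeredRP.one_lt_of_even_neZero hL)) _ _

/-- The kinetic insertion depends continuously on the `SU(N)` gauge field. [cite: SalmhoferSeiler1991, §2 (2.12)] -/
theorem coeffContinuous_kinAt_SU (x : TorusSite ν L) (b : Edge ν L) :
    CoeffContinuous fun V : GaugeConfig ν L (OneLink.SUN N) =>
      kinAt x (torusLinks ν L) (apSigns ν L) (fun b' => OneLink.inclSU N (V b')) b := by
  have hU : Continuous fun V : GaugeConfig ν L (OneLink.SUN N) =>
      ((OneLink.inclSU N (V b) : OneLink.UN N) : Matrix (Fin N) (Fin N) ℂ) :=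
    continuous_subtype_val.comp ((continuous_inclSU' (N := N)).comp (continuous_apply b))
  have hb : CoeffContinuous fun V : GaugeConfig ν L (OneLink.SUN N) =>
      bondTerm (torusLinks ν L) (apSigns ν L) (fun b' => OneLink.inclSU N (V b')) b := by
    unfold bondTerm
    exact ((coeffContinuous_hopAt _ _ hU).smul continuous_const).add
      ((coeffContinuous_hopAt _ _ hU.matrix_conjTranspose).smul continuous_const)
  exact hb.linearMap (chargeOp ℂ (barCharge (N := N) x))

omit [NeZero ν] [LinearOrder (TorusSite ν L)] in
/-- Continuous functions on the product `SU(N)^{links} × SU(N)` are integrable. [cite: SalmhoferSeiler1991, §2 (2.12)] -/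
theorem integrable_of_continuous_prod_SU {E : Type*} [NormedAddCommGroup E]
    {f : GaugeConfig ν L (OneLink.SUN N) × OneLink.SUN N → E} (hf : Continuous f) :
    Integrable f ((gaugeMeasureSU N (Edge ν L)).prod (haarProbability (OneLink.SUN N))) := by
  haveI : SecondCountableTopology (OneLink.SUN N) := by
    haveI : SecondCountableTopology (Matrix (Fin N) (Fin N) ℂ) :=
      inferInstanceAs (SecondCountableTopology (Fin N → Fin N → ℂ))
    exact TopologicalSpace.Subtype.secondCountableTopology _
  haveI : IsFiniteMeasure (gaugeMeasureSU N (Edge ν L)) := by unfold gaugeMeasureSU; infer_instance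
  exact hf.integrable_of_hasCompactSupport (HasCompactSupport.of_compactSpace f)

omit [NeZero ν] [NeZero L] [LinearOrder (TorusSite ν L)] in
/-- `(V, g) ↦ V[e←g]` is continuous. [cite: SalmhoferSeiler1991, §2 (2.12)] -/
theorem continuous_upd_SU (e : Edge ν L) :
    Continuous fun p : GaugeConfig ν L (OneLink.SUN N) × OneLink.SUN N => Function.update p.1 e p.2 :=
  continuous_fst.update e continuous_snd

/-- `V ↦ ∫dψ̄dψ G e^{A(V)}` is continuous. [cite: SalmhoferSeiler1991, §2 (2.12)] -/
theorem continuous_berezin_fWSU (hL : Even L) (G : FermiAlg (TorusSite ν L) N) :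
    Continuous fun V : GaugeConfig ν L (OneLink.SUN N) => berezin ℂ _ (G * fWSU V) :=
  continuous_apply_of_coeffContinuous ((CoeffContinuous.const G).mul (coeffContinuous_fWSU hL)) _

/-- `V ↦ ∫dψ̄dψ F kin_{x,e}(V) e^{A(V)}` is continuous. [cite: SalmhoferSeiler1991, §2 (2.12)] -/
theorem continuous_berezin_kin_fWSU (hL : Even L) (x : TorusSite ν L) (e : Edge ν L) (F : FermiAlg (TorusSite ν L) N) :
    Continuous fun V : GaugeConfig ν L (OneLink.SUN N) =>
      berezin ℂ _ (F * kinAt x (torusLinks ν L) (apSigns ν L) (fun b => OneLink.inclSU N (V b)) e * fWSU V) :=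
  continuous_apply_of_coeffContinuous (((CoeffContinuous.const F).mul (coeffContinuous_kinAt_SU x e)).mul
    (coeffContinuous_fWSU hL)) _

/-- `p ↦ ∫dψ̄dψ G e^{A(V[e←g])}` is continuous. [cite: SalmhoferSeiler1991, §2 (2.12)] -/
theorem continuous_berezin_upd_SU (hL : Even L) (e : Edge ν L) (G : FermiAlg (TorusSite ν L) N) :
    Continuous fun p : GaugeConfig ν L (OneLink.SUN N) × OneLink.SUN N =>
      berezin ℂ _ (G * fWSU (Function.update p.1 e p.2)) :=
  (continuous_berezin_fWSU hL G).comp (continuous_upd_SU e)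

/-- `p ↦ ∫dψ̄dψ F kin_{x,e}(V[e←g]) e^{A(V[e←g])}` is continuous. [cite: SalmhoferSeiler1991, §2 (2.12)] -/
theorem continuous_berezin_kin_upd_SU (hL : Even L) (x : TorusSite ν L) (e : Edge ν L) (F : FermiAlg (TorusSite ν L) N) :
    Continuous fun p : GaugeConfig ν L (OneLink.SUN N) × OneLink.SUN N =>
      berezin ℂ _ (F * kinAt x (torusLinks ν L) (apSigns ν L) (fun b => OneLink.inclSU N (Function.update p.1 e p.2 b)) e *
        fWSU (Function.update p.1 e p.2)) :=
  (continuous_berezin_kin_fWSU hL x e F).comp (continuous_upd_SU e)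

omit [NeZero ν] [LinearOrder (TorusSite ν L)] in
/-- `p ↦ e^{-βS_W(V[e←g])}` is continuous. [cite: SalmhoferSeiler1991, §2 (2.2)] -/
theorem continuous_plaqSU_upd (β : ℝ) (e : Edge ν L) :
    Continuous fun p : GaugeConfig ν L (OneLink.SUN N) × OneLink.SUN N => plaqSU N ν L β (Function.update p.1 e p.2) :=
  (continuous_plaqSU β).comp (continuous_upd_SU e)

omit [NeZero ν] [LinearOrder (TorusSite ν L)] in
/-- `p ↦ e^{-βS_W(V[e←1])}` is continuous. [cite: SalmhoferSeiler1991, §2 (2.2)] -/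
theorem continuous_plaqSU_upd_one (β : ℝ) (e : Edge ν L) :
    Continuous fun p : GaugeConfig ν L (OneLink.SUN N) × OneLink.SUN N => plaqSU N ν L β (Function.update p.1 e 1) :=
  (continuous_plaqSU β).comp (continuous_fst.update e continuous_const)

/-! ### Pointwise positivity, `S_β`, `J_β`, and the Schwinger–Dyson identity at `β` -/

/-- `s ∫dψ̄dψ G e^{A(V)} ≥ 0` and real at every `SU(N)` gauge field, `G` in the chiral cone. [cite: MontvayMunster1994, §5.1.6 (5.120)–(5.121)] -/
theorem chiralSign_mul_berezin_fWSU (hL : Even L) {G : FermiAlg (TorusSite ν L) N} (hG : IsChiralPositive (evens ν L) G)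
    (V : GaugeConfig ν L (OneLink.SUN N)) :
    0 ≤ (chiralSign (N := N) (evens ν L) * berezin ℂ _ (G * fWSU V)).re ∧
      (chiralSign (N := N) (evens ν L) * berezin ℂ _ (G * fWSU V)).im = 0 :=
  chiralSign_mul_berezin_actionOn_nonneg Finset.univ (torusLinks ν L) (fst_mem_evens_iff hL) conj_apSigns
    (fun b => OneLink.inclSU N (V b)) hG

/-- `s ∫dψ̄dψ G e^{A(V)}` equals its real part (`G` in the cone). [cite: MontvayMunster1994, §5.1.6 (5.120)–(5.121)] -/
theorem chiralSign_mul_berezin_fWSU_eq_re (hL : Even L) {G : FermiAlg (TorusSite ν L) N}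
    (hG : IsChiralPositive (evens ν L) G) (V : GaugeConfig ν L (OneLink.SUN N)) :
    chiralSign (N := N) (evens ν L) * berezin ℂ _ (G * fWSU V) =
      ((chiralSign (N := N) (evens ν L) * berezin ℂ _ (G * fWSU V)).re : ℂ) := by
  obtain ⟨_, him⟩ := chiralSign_mul_berezin_fWSU hL hG V
  rw [← Complex.re_add_im (chiralSign (N := N) (evens ν L) * berezin ℂ _ (G * fWSU V)), him]
  simp

/-- `J_β(G)` with the Boltzmann element written as `e^{A(V)}`. [cite: SalmhoferSeiler1991, §2 (2.9)–(2.12)] -/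
theorem suJB_eq (β : ℝ) (G : FermiAlg (TorusSite ν L) N) :
    suJB N ν L β G = ∫ V, (plaqSU N ν L β V : ℂ) * berezin ℂ _ (G * fWSU V) ∂(gaugeMeasureSU N (Edge ν L)) := by
  rw [suJB]
  exact integral_congr_ae (ae_of_all _ fun V => by dsimp only; rw [fermiBoltzmannSU_eq_fWSU])

/-- `S_β(G)` with the Boltzmann element written as `e^{A(V)}`. [cite: SalmhoferSeiler1991, §2 (2.9)–(2.12)] -/
theorem suSB_eq (β : ℝ) (G : FermiAlg (TorusSite ν L) N) :
    suSB N ν L β G = ∫ V, plaqSU N ν L β V * (chiralSign (N := N) (evens ν L) * berezin ℂ _ (G * fWSU V)).re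
      ∂(gaugeMeasureSU N (Edge ν L)) := by
  rw [suSB]
  exact integral_congr_ae (ae_of_all _ fun V => by dsimp only; rw [fermiBoltzmannSU_eq_fWSU])

/-- `Re(s · J_β(G)) = S_β(G)` for every `G`. [cite: SalmhoferSeiler1991, §2 (2.9)–(2.10)] -/
theorem re_chiralSign_mul_suJB (hL : Even L) (β : ℝ) (G : FermiAlg (TorusSite ν L) N) :
    (chiralSign (N := N) (evens ν L) * suJB N ν L β G).re = suSB N ν L β G := by
  have hint : Integrable (fun V => (plaqSU N ν L β V : ℂ) * (chiralSign (N := N) (evens ν L) * berezin ℂ _ (G * fWSU V)))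
      (gaugeMeasureSU N (Edge ν L)) :=
    integrable_of_continuous_SU ((Complex.continuous_ofReal.comp (continuous_plaqSU β)).mul
      (continuous_const.mul (continuous_berezin_fWSU hL G)))
  rw [suJB_eq, suSB_eq, ← integral_const_mul]
  simp_rw [mul_left_comm (chiralSign (N := N) (evens ν L))]
  rw [← RCLike.re_eq_complex_re, ← integral_re hint]
  refine integral_congr_ae (ae_of_all _ fun V => ?_)
  dsimp only
  rw [RCLike.re_eq_complex_re, Complex.re_ofReal_mul]

/-- **The Schwinger–Dyson equation at coupling `β` for `SU(N)`** (complex form): for `N_x F = nF`,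
`(N - n) J_β(F) = ∑_{e ∋ x} I_e(F)` — Grassmann integration by parts at every gauge field, integrated against
`e^{-βS_W}∏dV`. [cite: SalmhoferSeiler1991, (3.44)–(3.46) and (4.31)] -/
theorem suJB_schwingerDyson (hL : Even L) (β : ℝ) (x : TorusSite ν L) {F : FermiAlg (TorusSite ν L) N} {n : ℂ}
    (hFn : chargeOp ℂ (barCharge (N := N) x) F = n • F) :
    ((N : ℂ) - n) * suJB N ν L β F = ∑ e ∈ bondsAt ν L x, suKinJ N ν L β x e F := by
  have hpt : ∀ V : GaugeConfig ν L (OneLink.SUN N), ((N : ℂ) - n) * ((plaqSU N ν L β V : ℂ) * berezin ℂ _ (F * fWSU V)) =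
      ∑ e, (plaqSU N ν L β V : ℂ) * berezin ℂ _ (F *
        kinAt x (torusLinks ν L) (apSigns ν L) (fun b => OneLink.inclSU N (V b)) e * fWSU V) := by
    intro V
    rw [mul_left_comm, schwingerDyson_fixedGauge x Finset.univ (torusLinks ν L) (apSigns ν L) _ hFn, Finset.mul_sum]
  have hint : ∀ e : Edge ν L, Integrable (fun V : GaugeConfig ν L (OneLink.SUN N) => (plaqSU N ν L β V : ℂ) *
      berezin ℂ _ (F * kinAt x (torusLinks ν L) (apSigns ν L) (fun b => OneLink.inclSU N (V b)) e * fWSU V))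
      (gaugeMeasureSU N (Edge ν L)) := fun e =>
    integrable_of_continuous_SU ((Complex.continuous_ofReal.comp (continuous_plaqSU β)).mul (continuous_berezin_kin_fWSU hL x e F))
  rw [suJB_eq, ← integral_const_mul, integral_congr_ae (ae_of_all _ hpt), integral_finsetSum _ fun e _ => hint e,
    ← Finset.sum_filter_add_sum_filter_not Finset.univ (fun ℓ : Edge ν L => ℓ.1 = x ∨ ℓ.1.shift ℓ.2 = x), ← bondsAt]
  conv_rhs => rw [← add_zero (∑ e ∈ bondsAt ν L x, _)]
  unfold suKinJ
  congr 1
  refine Finset.sum_eq_zero fun e he => ?_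
  rw [Finset.mem_filter, not_or] at he
  have h0 : ∀ V : GaugeConfig ν L (OneLink.SUN N),
      kinAt x (torusLinks ν L) (apSigns ν L) (fun b => OneLink.inclSU N (V b)) e = 0 :=
    fun V => kinAt_eq_zero (l := torusLinks ν L) he.2.1 he.2.2 _ _
  simp [h0]

/-- **The real form of the Schwinger–Dyson equation at `β`**: `(N - n) S_β(F) = ∑_{e ∋ x} Re(s I_e(F))`
(`N_x F = nF`, `n` real). [cite: SalmhoferSeiler1991, (3.46) and (4.31)] -/
theorem suSB_schwingerDyson (hL : Even L) (β : ℝ) (x : TorusSite ν L) {F : FermiAlg (TorusSite ν L) N} {n : ℝ}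
    (hFn : chargeOp ℂ (barCharge (N := N) x) F = (n : ℂ) • F) :
    ((N : ℝ) - n) * suSB N ν L β F =
      ∑ e ∈ bondsAt ν L x, (chiralSign (N := N) (evens ν L) * suKinJ N ν L β x e F).re := by
  have h := congrArg (fun z => (chiralSign (N := N) (evens ν L) * z).re) (suJB_schwingerDyson hL β x hFn)
  simp only [Finset.mul_sum, Complex.re_sum] at h
  rw [← h, mul_left_comm, show ((N : ℂ) - n) = (((N : ℝ) - n : ℝ) : ℂ) by push_cast; ring, Complex.re_ofReal_mul,
    re_chiralSign_mul_suJB hL]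

/-! ### Resampling one link -/

/-- **`S_β(G)` in resampled form**: `S_β(G) = ∫∫ e^{-βS_W(V[e←g])} · s∫dψ̄dψ G e^{A(V[e←g])} dg ∏dV`. [cite: SalmhoferSeiler1991, §2 (2.12) and p. 400] -/
theorem suSB_eq_integral_prod (hL : Even L) (β : ℝ) (e : Edge ν L) (G : FermiAlg (TorusSite ν L) N) :
    suSB N ν L β G = ∫ p, plaqSU N ν L β (Function.update p.1 e p.2) *
      (chiralSign (N := N) (evens ν L) * berezin ℂ _ (G * fWSU (Function.update p.1 e p.2))).re
        ∂((gaugeMeasureSU N (Edge ν L)).prod (haarProbability (OneLink.SUN N))) := by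
  rw [suSB_eq, gaugeMeasureSU, ← integral_update_prod_eq (haarProbability (OneLink.SUN N)) e]
  exact integrable_of_continuous_SU ((continuous_plaqSU β).mul (Complex.continuous_re.comp
    (continuous_const.mul (continuous_berezin_fWSU hL G))))

/-- **The bond term in resampled form.** [cite: SalmhoferSeiler1991, §2 (2.12) and p. 400] -/
theorem suKinJ_eq_integral_prod (hL : Even L) (β : ℝ) (x : TorusSite ν L) (e : Edge ν L) (F : FermiAlg (TorusSite ν L) N) :
    suKinJ N ν L β x e F = ∫ p, (plaqSU N ν L β (Function.update p.1 e p.2) : ℂ) *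
      berezin ℂ _ (F * kinAt x (torusLinks ν L) (apSigns ν L) (fun b => OneLink.inclSU N (Function.update p.1 e p.2 b)) e *
        fWSU (Function.update p.1 e p.2)) ∂((gaugeMeasureSU N (Edge ν L)).prod (haarProbability (OneLink.SUN N))) := by
  rw [suKinJ, gaugeMeasureSU, ← integral_update_prod_eq (haarProbability (OneLink.SUN N)) e]
  exact integrable_of_continuous_SU ((Complex.continuous_ofReal.comp (continuous_plaqSU β)).mul
    (continuous_berezin_kin_fWSU hL x e F))

/-! ### The one-link oscillation of the `SU(N)` Wilson weight -/

omit [NeZero L] [LinearOrder (TorusSite ν L)] in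
/-- `|Re tr V| ≤ N` for `V ∈ SU(N)` in the defining representation. [cite: SeilerLNP1982, Ch. 2] -/
theorem abs_re_trace_suRep_le (g : OneLink.SUN N) :
    |((StaggeredRP.repMat (StaggeredRP.suRep N) g : Matrix (Fin N) (Fin N) ℂ).trace.re)| ≤ (N : ℝ) :=
  Literature.MathematicalPhysics.QuantumFieldTheory.abs_re_trace_le_of_mem_unitaryGroup
    (StaggeredRP.suRep N g).2

omit [NeZero ν] [LinearOrder (TorusSite ν L)] in
/-- **Changing one link moves the `SU(N)` Wilson action by at most `c = linkOsc ν N`**, uniformly in the volume. [cite: SeilerLNP1982, Ch. 2] -/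
theorem abs_wilsonActionSU_update_sub_le (V : GaugeConfig ν L (OneLink.SUN N)) (e : Edge ν L) (g h : OneLink.SUN N) :
    |wilsonAction (StaggeredRP.repMat (StaggeredRP.suRep N)) (Function.update V e g) -
        wilsonAction (StaggeredRP.repMat (StaggeredRP.suRep N)) (Function.update V e h)| ≤ linkOsc ν N := by
  have h1 := abs_wilsonAction_sub_wilsonAction_le (d := ν) (L := L) (StaggeredRP.repMat (StaggeredRP.suRep N)) (M := (N : ℝ))
    (fun g => abs_re_trace_suRep_le g) {e} (Function.update V e g) (Function.update V e h)
    (fun e' he' => by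
      rw [Finset.mem_singleton] at he'
      rw [Function.update_of_ne he', Function.update_of_ne he'])
  rwa [Finset.card_singleton, Nat.cast_one, ← linkOsc] at h1

omit [NeZero ν] [LinearOrder (TorusSite ν L)] in
/-- **`e^{-βS_W(V[e←g])} ≤ e^{βc} e^{-βS_W(V[e←h])}`**, `β ≥ 0`. [cite: SeilerLNP1982, Ch. 2] -/
theorem plaqSU_update_le {β : ℝ} (hβ : 0 ≤ β) (V : GaugeConfig ν L (OneLink.SUN N)) (e : Edge ν L) (g h : OneLink.SUN N) :
    plaqSU N ν L β (Function.update V e g) ≤ Real.exp (β * linkOsc ν N) * plaqSU N ν L β (Function.update V e h) := by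
  unfold plaqSU
  exact exp_neg_mul_le_of_abs_sub_le hβ (abs_wilsonActionSU_update_sub_le V e g h)

omit [NeZero ν] [LinearOrder (TorusSite ν L)] in
/-- **`|e^{-βS_W(V[e←g])} - e^{-βS_W(V[e←h])}| ≤ (e^{βc} - 1) e^{-βS_W(V[e←h])}`**, `β ≥ 0`. [cite: SeilerLNP1982, Ch. 2] -/
theorem abs_plaqSU_update_sub_le {β : ℝ} (hβ : 0 ≤ β) (V : GaugeConfig ν L (OneLink.SUN N)) (e : Edge ν L)
    (g h : OneLink.SUN N) :
    |plaqSU N ν L β (Function.update V e g) - plaqSU N ν L β (Function.update V e h)| ≤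
      (Real.exp (β * linkOsc ν N) - 1) * plaqSU N ν L β (Function.update V e h) := by
  unfold plaqSU
  exact abs_exp_neg_mul_sub_le_of_abs_sub_le hβ (abs_wilsonActionSU_update_sub_le V e g h)

/-! ### The pointwise bound for the kinetic insertion at every `SU(N)` gauge field -/

/-- **The kinetic insertion is controlled by the two neighbouring cone elements, at EVERY `SU(N)` gauge
field**: `|∫dψ̄dψ F kin_{x,e}(V) e^{A(V)}| ≤ (N√N/2)(s∫F(σσ)_e e^{A(V)} + s∫F e^{A(V)})` for `x` even, `e ∋ x`,
`F` in the cone. [cite: SalmhoferSeiler1991, (3.61)–(3.62)] [cite: MontvayMunster1994, §5.1.6 (5.120)–(5.121)] -/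
theorem norm_berezin_kinAt_le_SU (hL : Even L) (hN : N ≠ 0) {x : TorusSite ν L} (hx : x ∈ evens ν L) {e : Edge ν L}
    (hxe : (torusLinks ν L e).1 = x ∨ (torusLinks ν L e).2 = x) {F : FermiAlg (TorusSite ν L) N}
    (hF : IsChiralPositive (evens ν L) F) (V : GaugeConfig ν L (OneLink.SUN N)) :
    ‖berezin ℂ _ (F * kinAt x (torusLinks ν L) (apSigns ν L) (fun b => OneLink.inclSU N (V b)) e * fWSU V)‖ ≤
      ((N : ℝ) * Real.sqrt N / 2) *
        ((chiralSign (N := N) (evens ν L) *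
            berezin ℂ _ (F * spinPair (torusLinks ν L e).1 (torusLinks ν L e).2 * fWSU V)).re +
          (chiralSign (N := N) (evens ν L) * berezin ℂ _ (F * fWSU V)).re) := by
  have hle : (torusLinks ν L e).1 ≠ (torusLinks ν L e).2 := torusLinks_ne (StaggeredRP.one_lt_of_even_neZero hL) e
  have hl := fst_mem_evens_iff (ν := ν) hL
  set U : GaugeConfig ν L (OneLink.UN N) := fun b => OneLink.inclSU N (V b) with hU
  have key : ∀ (z : TorusSite ν L), z ∉ evens ν L → ∀ (M : Matrix (Fin N) (Fin N) ℂ), M ∈ Matrix.unitaryGroup (Fin N) ℂ →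
      (meson x * meson z : FermiAlg (TorusSite ν L) N) =
        (((2 * N : ℝ) ^ 2 : ℝ) : ℂ) • spinPair (torusLinks ν L e).1 (torusLinks ν L e).2 →
      ∀ c : ℂ, ‖c‖ = 1 / 2 →
      ‖berezin ℂ _ (F * (c • hopAt x z M) * fWSU V)‖ ≤ ((N : ℝ) * Real.sqrt N / 2) *
        ((chiralSign (N := N) (evens ν L) *
            berezin ℂ _ (F * spinPair (torusLinks ν L e).1 (torusLinks ν L e).2 * fWSU V)).re +
          (chiralSign (N := N) (evens ν L) * berezin ℂ _ (F * fWSU V)).re) := by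
    intro z hz M hM hMM c hc
    have hcs := norm_berezin_hopAt_actionOn_le Finset.univ (torusLinks ν L) hl conj_apSigns U hF hx hz M
    rw [hsNorm_of_mem_unitaryGroup hM, hMM] at hcs
    set r1 := (chiralSign (N := N) (evens ν L) *
      berezin ℂ _ (F * spinPair (torusLinks ν L e).1 (torusLinks ν L e).2 * fWSU V)).re with hr1
    set r0 := (chiralSign (N := N) (evens ν L) * berezin ℂ _ (F * fWSU V)).re with hr0
    have h1 : 0 ≤ r1 := (chiralSign_mul_berezin_fWSU hL (hF.mul (isChiralPositive_spinPair_pow _ _ 1)) V).1 |>.trans_eq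
      (by rw [hr1, pow_one])
    have h0 : 0 ≤ r0 := (chiralSign_mul_berezin_fWSU hL hF V).1
    have hsm : (chiralSign (N := N) (evens ν L) * berezin ℂ _ (F * ((((2 * N : ℝ) ^ 2 : ℝ) : ℂ) •
        spinPair (torusLinks ν L e).1 (torusLinks ν L e).2) * fWSU V)).re = (2 * N : ℝ) ^ 2 * r1 := by
      rw [mul_smul_comm, smul_mul_assoc, map_smul, smul_eq_mul, mul_left_comm, Complex.re_ofReal_mul, hr1]
    rw [hsm, Real.sqrt_mul' _ h1, Real.sqrt_sq (by positivity)] at hcs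
    rw [mul_smul_comm, smul_mul_assoc, map_smul, smul_eq_mul, norm_mul, hc]
    calc 1 / 2 * ‖berezin ℂ _ (F * hopAt x z M * grassmannExp (actionOn univ (torusLinks ν L) (apSigns ν L) U))‖
        ≤ 1 / 2 * (Real.sqrt N * (2 * N * Real.sqrt r1) * Real.sqrt r0) := mul_le_mul_of_nonneg_left hcs (by norm_num)
      _ = (N : ℝ) * Real.sqrt N / 2 * (2 * (Real.sqrt r1 * Real.sqrt r0)) := by ring
      _ ≤ (N : ℝ) * Real.sqrt N / 2 * (r1 + r0) :=
          mul_le_mul_of_nonneg_left (two_mul_sqrt_mul_sqrt_le h1 h0) (by positivity)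
  have hc : ‖apSigns ν L e / 2‖ = 1 / 2 := by
    rw [norm_div]
    rcases apSigns_eq_or (ν := ν) (L := L) e with h | h <;> simp [h]
  rcases hxe with h1 | h2
  · have h2 : (torusLinks ν L e).2 ≠ x := fun h => hle (h1.trans h.symm)
    have hz : (torusLinks ν L e).2 ∉ evens ν L := (hl e).mp (h1 ▸ hx)
    rw [kinAt_eq_of_fst h1 h2]
    refine key _ hz _ (U e).2 ?_ _ (by rw [norm_neg, hc])
    rw [← h1]; exact meson_mul_meson_eq_smul_spinPair hN _ _
  · have h1 : (torusLinks ν L e).1 ≠ x := fun h => hle (h.trans h2.symm)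
    have hz : (torusLinks ν L e).1 ∉ evens ν L := fun h => ((hl e).mp h) (h2 ▸ hx)
    rw [kinAt_eq_of_snd h1 h2]
    refine key _ hz _ (Unitary.star_mem (U e).2) ?_ _ hc
    rw [(commute_meson x _).eq, ← h2]; exact meson_mul_meson_eq_smul_spinPair hN _ _

end SchwingerDysonSU

end Summit.Ventures.YMGap.Conjectures

end
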